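import Summits.ResolutionOfSingularities.ResolutionOfSingularities.Theorems.WallFrames2
import Summits.ResolutionOfSingularities.ResolutionOfSingularities.Theorems.WallFrames6
import Summits.ResolutionOfSingularities.ResolutionOfSingularities.Theorems.NearCutPrimeShedding
import Summits.ResolutionOfSingularities.ResolutionOfSingularities.Theorems.ProximityCutArcLaw
import Summits.ResolutionOfSingularities.ResolutionOfSingularities.Theorems.PlanarGhostDescent
import Summits.ResolutionOfSingularities.ResolutionOfSingularities.Theorems.MaxContactCutWallCut
import HarnessLib

/-!
# WildDescent — Hironaka's β-descent in a LINEAR frame: the δ-balanced strict skew cells of the deep tight-defect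
# column (`WallCut.NoWildBalancedStrictTailsDeep`, the WILD cell `p ∣ s`, and its tame twin) hold HYPOTHESIS-FREE

Cell `decomp-res`, seat `decomp-res-lens-5`, generation 36 (critic row 226 / pre-ruling 226a «WildDescent»).  Main theorems
(§9): `noBalancedStrictSkewTailsDeep_pfree` (the common super-statement: the binders of the wild cell WITHOUT `p ∣ s`),
`noWildBalancedStrictTailsDeep_holds : WallCut.NoWildBalancedStrictTailsDeep` (verbatim, hypothesis-free),
`noTameBalancedStrictTailsDeep_of_pfree : WallCut.NoTameBalancedStrictTailsDeep` (control), and (§10) the column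
bookkeeping `defectWalksDeep_iff_boundary_lossy : MaxContactCut.DefectWalksDeep ↔ NoBalancedBoundaryTailsDeep ∧
NoLossyStrictTailsDeep` (hypothesis-free) / `defectWalksDeep_iff_lossy_of_port (hπ : BalancedWallPort)`.

## Mechanism (one paragraph)

Along a δ-balanced strict plateau the companion chain `G_{n+1} = translate b_n (chartTransform s j_n G_n)` (landed:
`NearCut.companion`, NEAR by `NearCut.companionLaw`, ISOLATED after a shedding stage by `NearCut.sheddingLemma`, pure
tangent cone `c_n ℓ_n^s` by `NearCut.directrix_of_plateau`, walls kept/lost by `NearCut.walls_succ`) carries at every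
stage two WALL letters `k_n, l_n` (exponent `δ`) and a FREE letter `f_n`; strictness makes `ℓ_n` TRANSVERSAL
(`∂ℓ_n/∂y_{f_n} ≠ 0`, `coeff_single_ne_zero_of_strict`).  We never prepare a vertex and never pass to a hypersurface of
maximal contact: the frame is the LINEAR shear `H_n = σ_{−η_n}(G_n)`, `η_n = (ℓ_k/ℓ_f) y_k + (ℓ_l/ℓ_f) y_l` (`frameH`), whose
tangent form is `c' y_f^s` (`frameH_in`); Hironaka's point set `Δ_n = Δ(H_n; u, v; f_n) ⊂ ℚ²` (`pts`, never convexified) is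
read in FIXED SLOTS (`slots`: the new wall inherits the slot of the lost wall, CJS §10), and `α, β, ε` are the lex-minimum
and the minimal ordinate (`lexMin`, `minSnd`).  A move losing the wall in slot 2 is a `Φ`-move (`(x,y) ↦ (x, x+y−1)`), in
slot 1 a `Ψ`-move.  LAWS (all kernel theorems of this file):

* L1 SLOTS `slots_spec` — the slots always hold the two walls; `phi_moves_io` / `psi_moves_io` — SKEWNESS (every
  letter is chart or translated infinitely often) forces both move types infinitely often.
* L2 FRAME `frameH_in`, `frameH_ord`, `G_eq_zshear_frameH` — normalised frame, order `s`, tangent form `c' y_f^s`.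
* L3 TRANSPORT `wall_step` (wall chart: transport law of the shear `WallFrames.transport_law` + nearness `a_l + b_f = 0`,
  `Δ(H^new) = T(Δ_n)` exactly: `pts_chartTransform_fst/snd`), `free_step` + `free_expansion` (free chart: the Θ-identity
  `y_f^s · σ(G') = H(y_f y_k, y_f U, a_l y_f y_l)`, nearness `1 + a_l β = 0`), `free_pts_up` / `free_pts_min`
  (`Δ(H^new) ⊆ ↑Φ(Δ_n)` and Pareto-minimal points of `Φ(Δ_n)` survive), packaged as `transported`.
* L4 RE-PREPARATION TEST `reprep_k` (the new tangent form `L` has no component on the kept wall: else `y_k^s ∈ Δ(H^new)`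
  off the new wall, against L6) and `reprep_E` (a component `λ_E y_E` of `L` puts the PURE POWER `λ_E^s y_E^s` into
  `in_s(H^new)`, i.e. a point with slot-`k` coordinate `0` dominating `T(Δ_n)` — impossible once `α_n > 0` (`Φ`) /
  `ε_n > 0` (`Ψ`)); then `next_frame_eq'`: the next frame polynomial IS `H^new`.  THIS is the step where `p ∣ s` bites in
  CJS (vertex preparation / solvability reads the mixed terms `s κ^{s−1} λ` of `(κ y_z + λ y_E)^s`, which vanish when
  `p ∣ s`); the linear frame reads the pure power `λ^s` (`single_mem_support_of_coeff`), which is characteristic-free.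
* L5 ISOLATION `framePts_exists_lt_one`, `alpha_le` — isolation of the `s`-fold point of `G_n` (`NearCut.IsolatedMult`)
  gives a point of `Δ_n` with first coordinate `< 1`, whence `α_n ≤ 1 − 1/s` (denominators `≤ s`: `pts_lattice`).
* L6 ENTRY `posE_of_dom`, `posE_zshear`, `pos_of_posE`, `step_laws`(.1) — after a `Φ`-move every point of `Δ_{n+1}` has
  ordinate `> 0`, after a `Ψ`-move abscissa `> 0`; `regime`: after one `Ψ`- and one later `Φ`-move, `α > 0` and `ε > 0`
  forever (exact transport keeps `α` at `Φ`-moves and does not lower `ε` at `Ψ`-moves: `step_laws`(.2)).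
* L7 DESCENT `beta_step` (`β_{n+1} ≤ β_n`, and `≤ β_n − 1/s` at a `Φ`-move since `β' = α + β − 1`, `α ≤ 1 − 1/s`),
  `beta_nonneg`, `wallChain_false` (infinitely many `Φ`-moves by L1 ⇒ `β → −∞`, contradiction).

## Hypothesis use (deletion probes, by located use)

`p ∣ s` — UNUSED (the super-statement `noBalancedStrictSkewTailsDeep_pfree` omits it; the tame cell is the same proof).
δ-BALANCE — `NearCut.walls_succ` (two walls, one kept with zero translation), `NearCut.companionLaw` / `sheddingLemma`
(near chain, isolation).  ISOLATION (`W.isolated` via `NearCut.sheddingLemma` ⇒ `IsolatedMult`) — ONLY in L5 (`alpha_le`);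
without it `α_n = 1 − 0` is possible and `β` need not drop.  `StaysOnNewest` RECURRENCE — only through the landed
`NearCut.directrix_of_plateau` (pure tangent cone) and `NearCut.sheddingLemma`.  SKEW / every-letter-i.o. — ONLY in L1
(`phi_moves_io`, `psi_moves_io`); without it a chain of `Ψ`-moves only (`β` constant) is consistent with L2–L7.  STRICT —
ONLY for transversality (`coeff_single_ne_zero_of_strict`).  `∀ M, ∃ t ≥ M, W.b t ≠ 0`, `∀ i, 1 ≤ shade`, `p^e + 3 ≤ 3s`,
`p^e + 2 ≤ 2s` — UNUSED; `3 ≤ s` only as `2 ≤ s` / `s ≠ 0`.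

## Placement / novelty (honest)

The invariant and the moves `Φ, Ψ` are Hironaka's (CJS LNM 2270 §§10–12, pp.124–137, for the DIRECTRIX-of-dimension-2
case in a prepared (well-prepared) coordinate system); new here is the frame: a linear shear re-normalised at every stage
instead of vertex preparation, for which the re-preparation test (L4) is a statement about a pure `s`-th power and hence
blind to the characteristic — so the δ-balanced strict WILD cell (`p ∣ s`), where maximal contact fails (Kollár 2.59), falls
to the same descent as the tame one.  Everything is typed against LANDED tree modules only (`WallFrames2` shear toolkit,
`NearCut*` companion/shedding/walls, `WallCutClasses`); no port hypothesis, no Literature fact as hypothesis, no kit.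
Sources: [cite: CossartJannsenSaito2020, §§10–12 (Lemmas 11.1, 11.2, 12.1, Thm 12.3) and Thm 5.40]; Kollár 2007, §2.7 (2.59) for the wild obstruction to maximal contact.

## Slicing

Verbatim slice 1/13 of the farm-checked monolith `WildDescent.lean` (cell `decomp-res`, seat `decomp-res-lens-5`, g36;
sha256 4ec0fa6f4f9efba7…); one namespace `Summit.ResolutionOfSingularities.ResolutionOfSingularities.Theorems.WildDescent` across the slices,
imports chained; the main theorem `noWildBalancedStrictTailsDeep_holds : WallCut.NoWildBalancedStrictTailsDeep` is in slice 13/13.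
This slice: §0 Algebra (pure-power coefficients, graded shear, Leibniz power law), Isolation vs a frame curve.
-/

open MvPolynomial Finset
open scoped BigOperators
open Literature.AlgebraicGeometry.Resolution
open Literature.AlgebraicGeometry.Resolution.Hauser2010
open Literature.AlgebraicGeometry.Resolution.PointBlowup
open Literature.AlgebraicGeometry.Resolution.HauserPerlega2024

namespace Summit.ResolutionOfSingularities.ResolutionOfSingularities.Theorems.WildDescent

/-! ## §0 Algebra: pure-power coefficients of linear forms, gradedness of the shear, Leibniz power law -/

section Algebra

variable {σ : Type*} [Fintype σ] [DecidableEq σ] {K : Type*} [Field K]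

/-- For a form `P` of degree `n`, its value at the `i`-th unit point is the coefficient of the pure power `y_i^n`.
[folklore] -/
theorem eval_single_of_isHomogeneous {P : MvPolynomial σ K} {n : ℕ} (hP : P.IsHomogeneous n) (i : σ) :
    eval (Pi.single i (1 : K)) P = coeff (Finsupp.single i n) P := by
  classical
  rw [eval_eq']
  rw [Finset.sum_eq_single (Finsupp.single i n)]
  · rw [Finset.prod_eq_one, mul_one]
    intro j _
    by_cases hj : j = i
    · subst hj; rw [Pi.single_eq_same, one_pow]
    · rw [Pi.single_eq_of_ne hj, Finsupp.single_apply, if_neg (Ne.symm hj), pow_zero]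
  · intro d hd hne
    have hdeg : d.degree = n := by
      rw [Finsupp.degree_eq_weight_one]; exact hP (mem_support_iff.mp hd)
    -- some `j ≠ i` carries a positive exponent
    have hj : ∃ j, j ≠ i ∧ d j ≠ 0 := by
      by_contra h
      push Not at h
      apply hne
      ext j
      by_cases hji : j = i
      · subst hji
        rw [Finsupp.single_eq_same]
        have : d = Finsupp.single j (d j) := by
          ext j'
          by_cases h' : j' = j
          · subst h'; rw [Finsupp.single_eq_same]
          · rw [Finsupp.single_apply, if_neg (Ne.symm h'), h j' h']
        rw [← hdeg, this, Finsupp.degree_single, Finsupp.single_eq_same]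
      · rw [Finsupp.single_apply, if_neg (Ne.symm hji), h j hji]
    obtain ⟨j, hji, hdj⟩ := hj
    rw [Finset.prod_eq_zero (Finset.mem_univ j) (by rw [Pi.single_eq_of_ne hji, zero_pow hdj]), mul_zero]
  · intro h
    rw [MvPolynomial.mem_support_iff, not_not] at h
    rw [h, zero_mul]

/-- The coefficient of `y_i^n` in the `n`-th power of a LINEAR form is the `n`-th power of its `y_i`-coefficient —
in EVERY characteristic (no binomial coefficients: evaluate at the unit point). [folklore] -/
theorem coeff_single_pow_of_isHomogeneous_one {ℓ : MvPolynomial σ K} (hℓ : ℓ.IsHomogeneous 1) (i : σ) (n : ℕ) :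
    coeff (Finsupp.single i n) (ℓ ^ n) = coeff (Finsupp.single i 1) ℓ ^ n := by
  have h := eval_single_of_isHomogeneous (hℓ.pow n) i
  rw [one_mul] at h
  rw [← h, map_pow, eval_single_of_isHomogeneous hℓ i]

/-- The same for `C c * ℓ^n`. [folklore] -/
theorem coeff_single_C_mul_pow {ℓ : MvPolynomial σ K} (hℓ : ℓ.IsHomogeneous 1) (c : K) (i : σ) (n : ℕ) :
    coeff (Finsupp.single i n) (C c * ℓ ^ n) = c * coeff (Finsupp.single i 1) ℓ ^ n := by
  rw [coeff_C_mul, coeff_single_pow_of_isHomogeneous_one hℓ]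

omit [Fintype σ] in
/-- The shear by a LINEAR form is graded: it maps forms of degree `n` to forms of degree `n`. [folklore] -/
theorem isHomogeneous_zshear {z : σ} {ζ : MvPolynomial σ K} (hζ : ζ.IsHomogeneous 1) {P : MvPolynomial σ K} {n : ℕ}
    (hP : P.IsHomogeneous n) : (WallFrames.zshear z ζ P).IsHomogeneous n := by
  have h := hP.aeval (fun i => if i = z then X z + ζ else (X i : MvPolynomial σ K)) (n := 1) (fun i => ?_)
  · rw [one_mul] at h; exact h
  · by_cases hi : i = z
    · subst hi; rw [if_pos rfl]; exact (isHomogeneous_X K i).add hζ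
    · rw [if_neg hi]; exact isHomogeneous_X K i

omit [Fintype σ] in
/-- Hence the shear by a linear form commutes with taking homogeneous components. [folklore] -/
theorem homogeneousComponent_zshear {z : σ} {ζ : MvPolynomial σ K} (hζ : ζ.IsHomogeneous 1) (P : MvPolynomial σ K)
    (n : ℕ) : homogeneousComponent n (WallFrames.zshear z ζ P) = WallFrames.zshear z ζ (homogeneousComponent n P) := by
  conv_lhs => rw [← sum_homogeneousComponent P]
  rw [map_sum, map_sum]
  rw [Finset.sum_eq_single n]
  · rw [homogeneousComponent_of_mem (isHomogeneous_zshear hζ (homogeneousComponent_isHomogeneous n P)), if_pos rfl]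
  · intro m _ hmn
    rw [homogeneousComponent_of_mem (isHomogeneous_zshear hζ (homogeneousComponent_isHomogeneous m P)), if_neg (Ne.symm hmn)]
  · intro hn
    rw [Finset.mem_range, not_lt] at hn
    rw [homogeneousComponent_eq_zero n P (by omega), map_zero, map_zero]

omit [Fintype σ] in
/-- The shear fixes the other variables' pure powers' coefficients… — elementary: `σ_ζ (C c * X z^n)` for LINEAR
`X z + ζ`: `σ_ζ (C c * ℓ'^n) = C c * (σ_ζ ℓ')^n`. [folklore] -/
theorem zshear_C_mul_pow (z : σ) (ζ ℓ : MvPolynomial σ K) (c : K) (n : ℕ) :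
    WallFrames.zshear z ζ (C c * ℓ ^ n) = C c * WallFrames.zshear z ζ ℓ ^ n := by
  rw [map_mul, WallFrames.zshear_C, map_pow]

-- writer g14: `hasseDeriv_mem_pow_sub'` deleted — dedup.landed twin of the landed `WallFrames.hasseDeriv_mem_pow_sub` (Theorems/WallFrames6); use sites cite the landed declaration.

end Algebra

section Isolation

variable {K : Type} [Field K]

/-- `multIdeal s G ⊆ I` whenever `G ∈ I^s`. [folklore] -/
theorem multIdeal_le_of_mem_pow {I : Ideal (MvPolynomial (Fin 3) K)} {s : ℕ} {G : MvPolynomial (Fin 3) K}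
    (hG : G ∈ I ^ s) : NearCut.multIdeal s G ≤ I := by
  unfold NearCut.multIdeal
  rw [Ideal.span_le]
  rintro _ ⟨d, hdq, rfl⟩
  have hdq' : d.degree < s := hdq
  have h := WallFrames.hasseDeriv_mem_pow_sub I s hG d  -- writer g14: landed twin (WallFrames6)
  have h1 : I ^ (s - d.degree) ≤ I ^ 1 := Ideal.pow_le_pow_right (by omega)
  simpa using h1 h

/-- **ISOLATION VERSUS A FRAME CURVE.**  If `G ∈ (y_u, y_f + a·y_u + b·y_v)^s` for three distinct variables then the
origin is NOT isolated in the multiplicity-`s` locus of `{G = 0}`: the regular curve `{y_u = 0, y_f = −b y_v}` is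
`s`-fold.  (Substitute `y_u ↦ 0`, `y_f ↦ −b·y_v`: the ideal dies, `y_v` survives, constant terms are kept.) [folklore] -/
theorem not_isolatedMult_of_mem_pow {u v f : Fin 3} (huv : u ≠ v) (huf : u ≠ f) (hvf : v ≠ f) (a b : K) {s : ℕ}
    {G : MvPolynomial (Fin 3) K}
    (hG : G ∈ Ideal.span {(X u : MvPolynomial (Fin 3) K), X f + C a * X u + C b * X v} ^ s) :
    ¬ NearCut.IsolatedMult s G := by
  classical
  rintro ⟨N, g, hg0, hg⟩
  set φ : MvPolynomial (Fin 3) K →ₐ[K] MvPolynomial (Fin 3) K :=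
    aeval (fun i => if i = u then 0 else if i = f then C (-b) * X v else X i) with hφ
  have hφu : φ (X u) = 0 := by rw [hφ, aeval_X, if_pos rfl]
  have hφf : φ (X f) = C (-b) * X v := by rw [hφ, aeval_X, if_neg (Ne.symm huf), if_pos rfl]
  have hφv : φ (X v) = X v := by rw [hφ, aeval_X, if_neg (Ne.symm huv), if_neg hvf]
  have hφℓ : φ (X f + C a * X u + C b * X v) = 0 := by
    rw [map_add, map_add, map_mul, map_mul, hφu, hφf, hφv, algHom_C, algHom_C, map_neg]
    simp only [MvPolynomial.algebraMap_eq]; ring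
  have hker : Ideal.span {(X u : MvPolynomial (Fin 3) K), X f + C a * X u + C b * X v} ≤
      RingHom.ker (φ : MvPolynomial (Fin 3) K →+* MvPolynomial (Fin 3) K) := by
    rw [Ideal.span_le]
    rintro x hx
    rcases hx with rfl | rfl
    · exact hφu
    · simpa using hφℓ
  have hmem : g * X v ^ N ∈ RingHom.ker (φ : MvPolynomial (Fin 3) K →+* MvPolynomial (Fin 3) K) :=
    hker (multIdeal_le_of_mem_pow hG (hg v))
  have hzero : φ g * X v ^ N = 0 := by
    have h := (RingHom.mem_ker).mp hmem
    rwa [RingHom.coe_coe, map_mul, map_pow, hφv] at h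
  have hg' : φ g = 0 := by
    rcases mul_eq_zero.mp hzero with h | h
    · exact h
    · exact absurd h (pow_ne_zero _ (X_ne_zero v))
  apply hg0
  have hcc : constantCoeff (φ g) = constantCoeff g := by
    rw [hφ]
    refine WallFrames.constantCoeff_aeval_of_forall (fun i => ?_) g
    by_cases hi : i = u
    · rw [if_pos hi, map_zero]
    · rw [if_neg hi]
      by_cases hif : i = f
      · rw [if_pos hif, map_mul, constantCoeff_C, constantCoeff_X, mul_zero]
      · rw [if_neg hif, constantCoeff_X]
  rw [← hcc, hg', map_zero]

end Isolation

end Summit.ResolutionOfSingularities.ResolutionOfSingularities.Theorems.WildDescent
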